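import Summits.BirchSwinnertonDyer.Rank1Residual.Iwasawa.LocalTowerKernelCardLeTamagawa
import Summits.BirchSwinnertonDyer.Rank1Residual.Additive.GordCycLowerBoundOfControlTamagawa
import Summits.BirchSwinnertonDyer.Rank1Residual.Additive.GordCycLowerBoundOfControlEnds
import Literature.NumberTheory.EllipticCurves.TamagawaNeZeroProofs
import Literature.NumberTheory.EllipticCurves.TamagawaRingEquivProofs
import HarnessLib

/-!
# The LOWER half in rank `0` from the typed input `CycLowerBoundAt` with the Tamagawa numbers and
# the bad places away from `p` FREE: the sharp count `#𝒦_{v,0}[p^∞] ≤ c_v^{(p)}` fed into CORE♯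
# (team n1011, row T-CTL-TAM, seat p06 GEN 10, FILE 7 — the consumer of FILE 6 = T-CTL-TAM♯)

HONEST FRAMING (cell `b2b-bsdres-*`, team n1011, verbatim): prove what is provable now; shrink each
hard class to its core with data; no claim beyond stated classes. Research route on
CONSTRUCTION-SHAPED X4 / §I N10–N11; TOOL + CONSUMER theorems only — no definition, no named fact,
nothing booked, no residual-map mark moved, no class closed. The typed input
`CycLowerBoundAt W p Dh` (additive-p2, OPEN) is consumed, not touched; the UPPER half is not touched.

## What

FILE 4 (`Additive/GordCycLowerBoundOfControlTamagawa`) proved CORE♯: in rank `0`,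
`CycLowerBoundAt ⟹ Typed.MissingLowerBoundAt` as soon as, at every `v ∈ S`, the `p`-power torsion
of the level-`0` local tower kernel is finite of order `≤ p ^ e_v` with `Σ_{v∈S} e_v ≤ ord_p Tam(E)`,
and discharged the exponents with `e_v = ord_p c_v` under the weak socket `p ∤ N_ℓ` at the bad `ℓ ≠ p`.
FILE 6 (`Iwasawa/LocalTowerKernelCardLeTamagawa`, T-CTL-TAM♯) proves Greenberg's SHARP count
`#𝒦_{v,0}[p^∞] ≤ p ^ ord_p c_v` at EVERY `v ∤ p`, for every `ℤ_p`-extension and every reduction type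
(Greenberg, LNM 1716, §3 Lemma 3.3 and §4 p. 74, through X11b's `index_range_decompSubOne_eq_pow`).
Hence the lower half needs NO hypothesis at the bad places away from `p` (and the class-agnostic
form no minimality of the model) — only the socket ABOVE `p` (`hp0`, discharged class-wide by p12's T-T3B F7 on the (G-ord) loci
and by T-T3M mod A41 on the (M) loci) and the place data `S / hgood` (so that `∏_{v∈S} c_v = Tam(E)`):

* `missingLowerBoundAt_rankZero_of_cycLowerBound_sharpCount` — class-agnostic: `hGZK`,
  `hr : r_an = 0`, `htors : p ∤ #E(ℚ)_tors`, `S`, `hp0`, `hgood`, ONE `Dh` with `hlow` ⟹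
  `MissingLowerBoundAt W p`;
* CLASS ENDS — binder diff against T-CTL-EC's `…_allNumeric` / FILE 4's `…_tamagawa`: the place
  hypothesis `hS` is REMOVED altogether (`[W.IsGloballyMinimal]` stays only because the socket
  theorems above `p` — p12's T-T3B F7 / T-T3M — carry it):
  `ClassX4Gord.missingLowerBoundAt_rankZero_of_cycLowerBound_tamagawaSharp (hX) (hGZK) (hr) (S) (hgood) (Dh) (hlow)`
  (every odd `p`), `ClassX3Gord.…` (`hp2`, `htors`), `ClassX4M.… (hT41)`, `ClassX3M.… (hT41) (htors)`;
* CAPSTONES: `ClassX4Gord.bsdp_rankZero_of_katoComponent_of_cycLowerBound_tamagawaSharp` (defect `2`,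
  `ρ̄` onto, every odd `p`), `ClassX4Gord.bsdp_rankZero_of_cycLeadingTerm_of_cycLowerBound_tamagawaSharp`
  (any defect, `p ≥ 5`), `ClassX4M.bsdp_rankZero_of_facts_of_cycLowerBound_tamagawaSharp` (`ρ̄` onto,
  every odd `p`; upper half the class-wide kernel theorem `AdditivePotMult.ClassX4M.missingUpperBoundAt_rankZero_of_surj`).

Census reading (EVIDENCE, r2's instrument; no label moves on this file's word): on r2 GEN 34's
column every `OPEN:LOWER(+M)+TAM` demand row @ ≥ 5 (13/13) and every `W = 2` TAM receiver @ 3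
(510/510) now reads like a `B = 0` row in the LOWER half — `MissingLowerBoundAt ⇐ CycLowerBoundAt`
(+ `hT41` on (M)). NOT claimed: the typed input (OPEN — nothing closes); the UPPER half and the
`W = 0` `OPEN:TAM` rows (Cassels–Poitou–Tate / L.4.7); rank `1`. Axioms standard.

References: [GreenbergLNM1716] §3 Lemma 3.3 (pp. 86–88), Lemma 3.5 (p. 90), Prop. 3.8 (pp. 95–96),
§4 Thm. 4.1 (pp. 102–104, p. 74); [Miller2011LMS] Def. 1.1; [SilvermanAEC2009] Cor. VII.6.2;
cells/n1011/skel/T-CTL-TAM.md §5.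
-/

noncomputable section

open scoped Classical NumberField

open WeierstrassCurve NumberField Literature.NumberTheory.EllipticCurves
  Literature.NumberTheory.EllipticCurves.ModularForms
  Literature.NumberTheory.EllipticCurves.Rank1Residual
  Literature.NumberTheory.EllipticCurves.Rank1Residual.Typed
  IsDedekindDomain Rat.HeightOneSpectrum Summit.BirchSwinnertonDyer.Rank1Residual.Iwasawa

namespace Summit.BirchSwinnertonDyer.Rank1Residual.Additive

variable (W : WeierstrassCurve ℚ) [W.IsElliptic] (p : ℕ) [hp : Fact p.Prime]

/-! ### §0 Bookkeeping -/

/-- `ord_p` of a finite product of non-zero naturals is the sum of the `ord_p`. [folklore] -/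
private theorem padicValNat_finset_prod' {ι : Type*} (s : Finset ι) (f : ι → ℕ)
    (hf : ∀ i ∈ s, f i ≠ 0) : padicValNat p (∏ i ∈ s, f i) = ∑ i ∈ s, padicValNat p (f i) := by
  induction s using Finset.cons_induction with
  | empty => simp
  | cons a s ha ih =>
    rw [Finset.prod_cons, Finset.sum_cons,
      padicValNat.mul (hf a (Finset.mem_cons_self a s))
        (Finset.prod_ne_zero_iff.mpr fun i hi ↦ hf i (Finset.mem_cons_of_mem hi)),
      ih fun i hi ↦ hf i (Finset.mem_cons_of_mem hi)]

omit hp in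
/-- `c_v ≠ 0` at every finite place of `ℚ` (Silverman Cor. VII.6.2, tree
`localTamagawaNumber_padic_ne_zero_holds` transported by `localTamagawaNumber_padic_eq_holds`).
[cite: SilvermanAEC2009, Cor. VII.6.2] -/
theorem localTamagawaNumber_adicCompletion_ne_zero (v : HeightOneSpectrum (𝓞 ℚ)) :
    (W.baseChange (v.adicCompletion ℚ)).localTamagawaNumber (v.adicCompletionIntegers ℚ) ≠ 0 := by
  haveI : Fact (Nat.Prime (primesEquiv v : ℕ)) := ⟨(primesEquiv v).2⟩
  rw [← localTamagawaNumber_padic_eq_holds W v (primesEquiv v : ℕ) rfl]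
  exact localTamagawaNumber_padic_ne_zero_holds (primesEquiv v : ℕ) (W.baseChange ℚ_[(primesEquiv v : ℕ)])

/-! ### §1 The lower half with the bad places away from `p` FREE -/

/-- **Rank `0`, any prime `p`: `CycLowerBoundAt ⟹ MissingLowerBoundAt` with the Tamagawa numbers and
the bad places away from `p` FREE.** Let `W/ℚ` be elliptic with analytic rank `0`; grant GZK (`hGZK`).
Assume `p ∤ #E(ℚ)_tors`; let `S` be a finite set of places off which every place is prime to `p` and
good (`hgood`; so `∏_{v∈S} c_v = Tam(E)`); assume the socket ABOVE `p` (`hp0`: `𝒦_{v,0}[p^∞] = ⊥` at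
`v ∈ S`, `v ∣ p`, every `ℤ_p`-extension) and `CycLowerBoundAt W p Dh` for ONE height datum. Then
`Typed.MissingLowerBoundAt W p`. Mechanism: CORE♯ (FILE 4) with `e_v = ord_p c_v`, the exponents
supplied at `v ∤ p` by the SHARP count of FILE 6 (`#𝒦_{v,0}[p^∞] ≤ p ^ ord_p c_v`, no hypothesis) and
trivially above `p`; `Σ_{v∈S} ord_p c_v = ord_p Tam`. No `p ∤ c_ℓ`, no `p ∤ N_ℓ`, no minimality, no
Delbourgo (A)/(B), no duality. [cite: GreenbergLNM1716, §3 Lemma 3.3 (pp. 86–88), Lemma 3.5 (p. 90) and §4 Thm. 4.1 (pp. 102–104, p. 74)]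
[cite: Miller2011LMS, Def. 1.1] -/
theorem missingLowerBoundAt_rankZero_of_cycLowerBound_sharpCount
    (hGZK : rank_eq_analyticRank_of_analyticRank_le_one) (hr : W.analyticRank = 0)
    (htors : ¬ p ∣ W.torsionOrder) (S : Finset (HeightOneSpectrum (𝓞 ℚ)))
    (hp0 : ∀ (κ : ZpExtension ℚ p), ∀ v ∈ S, (p : 𝓞 ℚ) ∈ v.asIdeal →
      W.localTowerKerPrimary κ (v.adicCompletion ℚ) 0 = ⊥)
    (hgood : ∀ v ∉ S, (p : 𝓞 ℚ) ∉ v.asIdeal ∧ W.HasGoodReductionAt v)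
    (Dh : PAdicHeightData W p) (hlow : CycLowerBoundAt W p Dh) :
    MissingLowerBoundAt W p := by
  refine missingLowerBoundAt_rankZero_of_cycLowerBound_of_localCount W p hGZK hr htors S
    (fun v ↦ padicValNat p
      ((W.baseChange (v.adicCompletion ℚ)).localTamagawaNumber (v.adicCompletionIntegers ℚ)))
    (fun κ _ v hv ↦ ?_) hgood (le_of_eq ?_) Dh hlow
  · by_cases hpv : (p : 𝓞 ℚ) ∈ v.asIdeal
    · have hbot := hp0 κ v hv hpv
      refine ⟨?_, ?_⟩
      · rw [hbot]; infer_instance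
      · rw [hbot, AddSubgroup.card_bot]; exact Nat.one_le_pow _ _ hp.out.pos
    · exact finite_and_natCard_localTowerKerPrimary_zero_le_pow_padicValNat_localTamagawaNumber W κ
        hpv
  · rw [tamagawaProduct_eq_prod_of_good W S fun v hv ↦ (hgood v hv).2,
      padicValNat_finset_prod' p S _ fun v _ ↦ localTamagawaNumber_adicCompletion_ne_zero W v]

/-! ### §2 CLASS ENDS — no place hypothesis away from `p`, no minimality -/

variable {W p} in
/-- **X4♯(G-ord), rank `0`, EVERY odd `p`: the lower half from the typed input, Tamagawa numbers and
bad places away from `p` FREE.** Socket above `p`: p12's T-T3B F7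
`GoodModelLine.ClassX4Gord.localTowerKerPrimary_zero_eq_bot` (every `ℤ_p`-extension, no anomaly
clause); `p ∤ #tors` is `Irr`. Binders: `hX`, `hGZK`, `hr`, `S / hgood` (census place list), `Dh`, `hlow`
— binder diff vs T-CTL-EC's `…_allNumeric` and FILE 4's `…_tamagawa`: `hS` REMOVED (nothing else;
`[W.IsGloballyMinimal]` is the socket theorem's). X4 stays CONSTRUCTION-SHAPED; the typed input stays OPEN; nothing
booked. [cite: GreenbergLNM1716, §3 Lemma 3.3 (pp. 86–88), Lemma 3.4 (p. 89), Lemma 3.5 (p. 90) and §4 Thm. 4.1 (pp. 102–104, p. 74)]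
[cite: Miller2011LMS, Def. 1.1] -/
theorem ClassX4Gord.missingLowerBoundAt_rankZero_of_cycLowerBound_tamagawaSharp [W.IsGloballyMinimal]
    (hX : ClassX4Gord W p) (hGZK : rank_eq_analyticRank_of_analyticRank_le_one)
    (hr : W.analyticRank = 0) (S : Finset (HeightOneSpectrum (𝓞 ℚ)))
    (hgood : ∀ v ∉ S, (p : 𝓞 ℚ) ∉ v.asIdeal ∧ W.HasGoodReductionAt v)
    (Dh : PAdicHeightData W p) (hlow : CycLowerBoundAt W p Dh) :
    MissingLowerBoundAt W p :=
  missingLowerBoundAt_rankZero_of_cycLowerBound_sharpCount W p hGZK hr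
    (Supersingular.not_dvd_torsionOrder_of_irr W p hX.1.2.2) S
    (fun κ _ _ hpv ↦ GoodModelLine.ClassX4Gord.localTowerKerPrimary_zero_eq_bot hX hpv κ) hgood Dh
    hlow

variable {W p} in
/-- **X3♯(G-ord), rank `0`, EVERY odd `p`, `p ∤ #E(ℚ)_tors` explicit: the lower half from the typed
input, bad places away from `p` FREE.** Socket above `p`: T-T3B F7
`GoodModelLine.ClassX3Gord.localTowerKerPrimary_zero_eq_bot`. X3 stays as labelled; nothing booked.
[cite: GreenbergLNM1716, §3 Lemma 3.3 (pp. 86–88), Lemma 3.4 (p. 89), Lemma 3.5 (p. 90) and §4 Thm. 4.1 (pp. 102–104, p. 74)]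
[cite: Miller2011LMS, Def. 1.1] -/
theorem ClassX3Gord.missingLowerBoundAt_rankZero_of_cycLowerBound_tamagawaSharp [W.IsGloballyMinimal]
    (hp2 : p ≠ 2) (hX : ClassX3Gord W p) (hGZK : rank_eq_analyticRank_of_analyticRank_le_one)
    (hr : W.analyticRank = 0) (htors : ¬ p ∣ W.torsionOrder) (S : Finset (HeightOneSpectrum (𝓞 ℚ)))
    (hgood : ∀ v ∉ S, (p : 𝓞 ℚ) ∉ v.asIdeal ∧ W.HasGoodReductionAt v)
    (Dh : PAdicHeightData W p) (hlow : CycLowerBoundAt W p Dh) :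
    MissingLowerBoundAt W p :=
  missingLowerBoundAt_rankZero_of_cycLowerBound_sharpCount W p hGZK hr htors S
    (fun κ _ _ hpv ↦ GoodModelLine.ClassX3Gord.localTowerKerPrimary_zero_eq_bot hp2 hX hpv κ) hgood
    Dh hlow

variable {W p} in
/-- **X4(M), rank `0`, EVERY odd `p` (incl. `p = 3`): the lower half from the typed input, mod A41,
Tamagawa numbers and bad places away from `p` FREE.** Socket above `p`: p12's T-T3M
`AdditivePotMult.ClassX4M.localTowerKerPrimary_zero_eq_bot hT41`; `p ∤ #tors` is `Irr`. X4(M) stays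
CONSTRUCTION-SHAPED; the typed input stays OPEN; nothing booked.
[cite: SilvermanATAEC1994, Ch. V Thm. 5.3, Cor. 5.4] [cite: Delbourgo1998, §2.2 Lemma (ii) (p. 139)]
[cite: GreenbergLNM1716, §3 Lemma 3.3 (pp. 86–88), Lemma 3.5 (p. 90) and §4 Thm. 4.1 (pp. 102–104, p. 74)]
[cite: Miller2011LMS, Def. 1.1] -/
theorem ClassX4M.missingLowerBoundAt_rankZero_of_cycLowerBound_tamagawaSharp [W.IsGloballyMinimal]
    (hT41 : Silverman1994_thmV53_corV54_tateUniformisation.{0})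
    (hX : AdditivePotMult.ClassX4M W p)
    (hGZK : rank_eq_analyticRank_of_analyticRank_le_one) (hr : W.analyticRank = 0)
    (S : Finset (HeightOneSpectrum (𝓞 ℚ)))
    (hgood : ∀ v ∉ S, (p : 𝓞 ℚ) ∉ v.asIdeal ∧ W.HasGoodReductionAt v)
    (Dh : PAdicHeightData W p) (hlow : CycLowerBoundAt W p Dh) :
    MissingLowerBoundAt W p :=
  missingLowerBoundAt_rankZero_of_cycLowerBound_sharpCount W p hGZK hr
    (Supersingular.not_dvd_torsionOrder_of_irr W p hX.irr) S
    (fun κ _ _ hpv ↦ AdditivePotMult.ClassX4M.localTowerKerPrimary_zero_eq_bot hT41 hX hpv κ) hgood Dh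
    hlow

variable {W p} in
/-- **X3♯(M), rank `0`, EVERY odd `p`, `p ∤ #E(ℚ)_tors` explicit: the lower half from the typed input,
mod A41, bad places away from `p` FREE.** Nothing booked.
[cite: SilvermanATAEC1994, Ch. V Thm. 5.3, Cor. 5.4]
[cite: GreenbergLNM1716, §3 Lemma 3.3 (pp. 86–88), Lemma 3.5 (p. 90) and §4 Thm. 4.1 (pp. 102–104, p. 74)]
[cite: Miller2011LMS, Def. 1.1] -/
theorem ClassX3M.missingLowerBoundAt_rankZero_of_cycLowerBound_tamagawaSharp [W.IsGloballyMinimal]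
    (hT41 : Silverman1994_thmV53_corV54_tateUniformisation.{0})
    (hX : AdditivePotMult.ClassX3M W p)
    (hGZK : rank_eq_analyticRank_of_analyticRank_le_one) (hr : W.analyticRank = 0)
    (htors : ¬ p ∣ W.torsionOrder) (S : Finset (HeightOneSpectrum (𝓞 ℚ)))
    (hgood : ∀ v ∉ S, (p : 𝓞 ℚ) ∉ v.asIdeal ∧ W.HasGoodReductionAt v)
    (Dh : PAdicHeightData W p) (hlow : CycLowerBoundAt W p Dh) :
    MissingLowerBoundAt W p :=
  missingLowerBoundAt_rankZero_of_cycLowerBound_sharpCount W p hGZK hr htors S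
    (fun κ _ _ hpv ↦ AdditivePotMult.ClassX3M.localTowerKerPrimary_zero_eq_bot hT41 hX hpv κ) hgood Dh
    hlow

/-! ### §3 CAPSTONES -/

variable {W p} in
/-- **X4♯(G-ord) ∩ `I₀*` (defect `2`), `r_an = 0`, `ρ̄_{E,p}` onto, EVERY odd `p` (at `p = 3`: `Ram`):
`BSD(E,p)` from PRINTED facts (Kato 17.4 (3) component `hK`, Delbourgo 1998 Prop. 4 `hDel98`, GZK,
modularity), the census place list `S / hgood` (NO condition at the bad places away from `p`;
`W` globally minimal only for the tree END's own currency), and the ONE typed input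
`CycLowerBoundAt W p Dh`** — the tree END `ClassX4Gord.bsdp_rankZero_of_katoComponent_of_lower` fed
with this file's lower half. X4 stays CONSTRUCTION-SHAPED (typed input OPEN); nothing booked.
[cite: Kato2004Asterisque, Thm. 17.4 (3) (p. 273)] [cite: Delbourgo1998, Prop. 4 (p. 144)]
[cite: GreenbergLNM1716, §3 Lemma 3.3 (pp. 86–88), Lemma 3.5 (p. 90) and §4 Thm. 4.1 (pp. 102–104, p. 74)] [cite: Miller2011LMS, Def. 1.1] -/
theorem ClassX4Gord.bsdp_rankZero_of_katoComponent_of_cycLowerBound_tamagawaSharp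
    [W.IsGloballyMinimal]
    (hK : Kato2004.charIdeal_dvd_padicLFunctionBranch_component_of_surjective)
    (hDel98 : Delbourgo1998.prop4_rankZero_pow_dvd_constantCoeff)
    (hGZK : rank_eq_analyticRank_of_analyticRank_le_one) (hmod : hasEntireLFunction_rat)
    (hmodD : nonempty_modularParametrizationData)
    (hX : ClassX4Gord W p) (he : semistabilityIndex W p = 2) (hr : W.analyticRank = 0)
    (hsurj : Surj W p) (hram3 : p = 3 → Ram W p) (S : Finset (HeightOneSpectrum (𝓞 ℚ)))
    (hgood : ∀ v ∉ S, (p : 𝓞 ℚ) ∉ v.asIdeal ∧ W.HasGoodReductionAt v)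
    (Dh : PAdicHeightData W p) (hlow : CycLowerBoundAt W p Dh) : BSDp W p :=
  ClassX4Gord.bsdp_rankZero_of_katoComponent_of_lower hK hDel98 hGZK hmod hmodD hX he hr hsurj hram3
    (ClassX4Gord.missingLowerBoundAt_rankZero_of_cycLowerBound_tamagawaSharp hX hGZK hr S hgood Dh
      hlow)

variable {W p} in
/-- **X4♯(G-ord), ANY defect, `p ≥ 5`, `r_an = 0`: `BSD(E,p)` from the TWO typed cyclotomic inputs at
`T = 0`, Delbourgo 1998 Prop. 4, GZK, modularity and the census place list (NO condition at the bad
places away from `p`)** — the tree END `ClassX4Gord.bsdp_rankZero_of_cycLeadingTerm_of_lower` fed with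
this file's lower half. X4 stays CONSTRUCTION-SHAPED (both typed inputs OPEN); nothing booked.
[cite: Delbourgo1998, Prop. 4 (p. 144)] [cite: GreenbergLNM1716, §3 Lemma 3.3 (pp. 86–88), Lemma 3.5 (p. 90) and §4 Thm. 4.1 (pp. 102–104, p. 74)]
[cite: Miller2011LMS, Def. 1.1] -/
theorem ClassX4Gord.bsdp_rankZero_of_cycLeadingTerm_of_cycLowerBound_tamagawaSharp
    [W.IsGloballyMinimal] (hDel98 : Delbourgo1998.prop4_rankZero_pow_dvd_constantCoeff)
    (hGZK : rank_eq_analyticRank_of_analyticRank_le_one) (hmod : hasEntireLFunction_rat)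
    (hX : ClassX4Gord W p) (hp5 : 5 ≤ p) (hr : W.analyticRank = 0) (hLT : CycLeadingTermAt W p)
    (S : Finset (HeightOneSpectrum (𝓞 ℚ)))
    (hgood : ∀ v ∉ S, (p : 𝓞 ℚ) ∉ v.asIdeal ∧ W.HasGoodReductionAt v)
    (Dh : PAdicHeightData W p) (hlow : CycLowerBoundAt W p Dh) : BSDp W p :=
  ClassX4Gord.bsdp_rankZero_of_cycLeadingTerm_of_lower hDel98 hGZK hmod hX hp5 hr hLT
    (ClassX4Gord.missingLowerBoundAt_rankZero_of_cycLowerBound_tamagawaSharp hX hGZK hr S hgood Dh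
      hlow)

variable {W p} in
/-- **X4(M), `r_an = 0`, `ρ̄_{E,p}` onto, EVERY odd `p`: `BSD(E,p)` from PRINTED facts (Tate A41 `hT41`,
Delbourgo 1998 Prop. 4, GZK, modularity, Wuthrich Lemma 20 / Kato `ω^{(p−1)/2}`-component), the
census place list `S / hgood` (NO condition at the bad places away from `p`) and the ONE typed input
`CycLowerBoundAt W p Dh`** — upper half = the class-wide kernel theorem
`AdditivePotMult.ClassX4M.missingUpperBoundAt_rankZero_of_surj` (no place data), lower half = this
file's (M) END. On r2's GEN 34 column (EVIDENCE) this is the shape read by ALL the `OPEN:LOWER(M)+TAM`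
demand rows @ 5 (8, all (M)) and every (M)-surj `W = 2` receiver @ 3 — no `p ∤ N_ℓ` test any more.
X4(M) stays CONSTRUCTION-SHAPED (typed input OPEN); nothing booked; no label moves on this theorem's
word. [cite: Delbourgo1998, Prop. 4 (p. 144)] [cite: SilvermanATAEC1994, Ch. V Thm. 5.3, Cor. 5.4]
[cite: GreenbergLNM1716, §3 Lemma 3.3 (pp. 86–88), Lemma 3.5 (p. 90) and §4 Thm. 4.1 (pp. 102–104, p. 74)] [cite: Miller2011LMS, Def. 1.1] -/
theorem ClassX4M.bsdp_rankZero_of_facts_of_cycLowerBound_tamagawaSharp [W.IsGloballyMinimal]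
    (hT41 : Silverman1994_thmV53_corV54_tateUniformisation.{0})
    (hDel98 : Delbourgo1998.prop4_rankZero_pow_dvd_constantCoeff)
    (hGZK : rank_eq_analyticRank_of_analyticRank_le_one) (hmod : hasEntireLFunction_rat)
    (hmodD : nonempty_modularParametrizationData)
    (hL20 : Wuthrich2014.lemma20_surjective_threeAdic_of_semistable)
    (hKato : Wuthrich2014.kato_halfEigenCharIdeal_dvd_cyclotomicPrime_of_surjective)
    (hX : AdditivePotMult.ClassX4M W p) (hr : W.analyticRank = 0) (hsurj : Surj W p)
    (S : Finset (HeightOneSpectrum (𝓞 ℚ)))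
    (hgood : ∀ v ∉ S, (p : 𝓞 ℚ) ∉ v.asIdeal ∧ W.HasGoodReductionAt v)
    (Dh : PAdicHeightData W p) (hlow : CycLowerBoundAt W p Dh) : BSDp W p :=
  bsdp_of_missingPPartAt W p hGZK (by rw [hr]; exact zero_le_one)
    (missingPPartAt_of_lower_of_upper W p
      (ClassX4M.missingLowerBoundAt_rankZero_of_cycLowerBound_tamagawaSharp hT41 hX hGZK hr S hgood
        Dh hlow)
      (AdditivePotMult.ClassX4M.missingUpperBoundAt_rankZero_of_surj hDel98 hGZK hmod hmodD hL20 hKato hX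
        hr hsurj))

end Summit.BirchSwinnertonDyer.Rank1Residual.Additive

end
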